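import Summits.Parity.BatemanHorn.Theses.SelbergDelangeRigidity
import Summits.Parity.BatemanHorn.Theorems.SystemLSDRealSegment.Negative.Engines
import Summits.Parity.BatemanHorn.Theorems.SystemLSDRealSegment.Negative.DivisorBound

/-!
# `LSDRealSegment` — three fields of `IsBatemanHornSystem` are load-bearing, the fourth is not; `k = 0` holds

Negative-side theorems for the crux `Summit.Parity.BatemanHorn.Theses.SelbergDelangeRigidity.LSDRealSegment`
(stmt-Parity-9770), from the standing disprover's work file `Cruxes/LSDRealSegment/Disproof.lean` §2–§3. For each
field `H` of the hypothesis `IsBatemanHornSystem f` we state the crux WITH `H` DROPPED (the conclusion inlined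
verbatim, statistic `Ω_f(n) = Σ_i Ω(f_i(n))` = `ArithmeticFunction.cardFactors`, NO cap) and decide it:

* `lsdRealSegment_false_without_leadingCoeff_pos` — witness `![-X]`: the typed statistic (`Int.toNat`) vanishes,
  the normalised sum tends to `0` on the segment, so `Λ ≡ 0` there and `Λ 0 = 0` by the identity theorem, against
  `C(-X) = 1`;
* `lsdRealSegment_false_without_irreducible` — witness `![X ^ 2]` at `y = 3/2`: `Ω(n²) = 2Ω(n) ≥ 2ω(n)`,
  `Σ y^{Ω_f} ≥ Σ 2^{ω} ≥ (x/2) log x - x`, the normalised sum diverges;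
* `lsdRealSegment_false_without_pairwise_not_associated` — witness `![X, X]` at `y = 29/20`: `Ω_f = 2Ω(n) ≥ 2ω(n)`,
  diverges;
* `lsdRealSegment_conclusion_C_three` — the junk model `![C 3]` (fixed prime divisor `3`, the three other fields
  hold) SATISFIES the conclusion (`Λ ≡ 0 = C`): `hasNoFixedPrimeDivisor` is not what a disproof can lean on;
* `lsdRealSegment_fin_zero` — the degenerate instance `k = 0` HOLDS (`Λ ≡ 1`, `C(∅) = 1`): no refutation from the
  empty system; the prover's `k = 0` branch is ready-made.

The generic engines (`eqOn_ball_of_eqOn_segment`, `tendsto_atTop_of_lower_envelope`, …) and the divisor bound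
`sum_two_pow_omega_ge` are imported from the capped sibling's `Theorems/SystemLSDRealSegment/Negative/{Engines,DivisorBound}`
(Mathlib-only dependencies); the small arithmetic facts about the witnesses (root counts, `C(f)` values) are re-proved here as
private lemmas so that this file does not depend on the sibling route's thesis file.
-/

open Filter Polynomial Finset
open scoped Topology

namespace Summit.Parity.BatemanHorn.Theorems.LSDRealSegment.Negative

open Literature.NumberTheory.Sieve
open Summit.Parity.BatemanHorn.Theorems.SystemLSDRealSegment.Negative
open ArithmeticFunction (cardFactors)

/-! ## Common bookkeeping -/

/-- The complex Ω-normalised sum of the crux is the real one coerced. [folklore] -/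
theorem omegaNormSum_eq_ofReal (k : ℕ) (f : Fin k → ℤ[X]) (y : ℝ) (x : ℕ) :
    (x : ℂ)⁻¹ * Complex.exp ((k : ℂ) * (1 - (y : ℂ)) * (Real.log (Real.log x) : ℂ)) *
        ∑ n ∈ Finset.range (x + 1), (y : ℂ) ^ (∑ i, cardFactors (((f i).eval (n : ℤ)).toNat)) =
      (((x : ℝ)⁻¹ * Real.exp (k * (1 - y) * Real.log (Real.log x)) *
        ∑ n ∈ Finset.range (x + 1), y ^ (∑ i, cardFactors (((f i).eval (n : ℤ)).toNat)) : ℝ) : ℂ) := by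
  push_cast
  rfl

/-- `ω(n) ≤ Ω(n)` in the form `#primeFactors n ≤ cardFactors n`. [folklore] -/
theorem card_primeFactors_le_cardFactors (n : ℕ) : n.primeFactors.card ≤ cardFactors n := by
  rw [ArithmeticFunction.cardFactors_apply, ← Nat.toFinset_factors]
  exact List.toFinset_card_le _

/-- `2^{ω(n)} ≤ y^{2 Ω(n)}` once `y² ≥ 2`. [folklore] -/
theorem two_pow_omega_le_pow_two_mul_cardFactors {y : ℝ} (hy : 2 ≤ y ^ 2) (n : ℕ) :
    (2 : ℝ) ^ n.primeFactors.card ≤ y ^ (2 * cardFactors n) :=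
  calc (2 : ℝ) ^ n.primeFactors.card ≤ (2 : ℝ) ^ cardFactors n :=
        pow_le_pow_right₀ (by norm_num) (card_primeFactors_le_cardFactors n)
    _ ≤ (y ^ 2) ^ cardFactors n := pow_le_pow_left₀ (by norm_num) hy _
    _ = y ^ (2 * cardFactors n) := (pow_mul y 2 _).symm


/-! ## Private arithmetic facts about the witnesses (as in the sibling's `LoadBearing`/`FinZero`) -/

/-- If `p ∣ ∏ f_i(n) ↔ p ∣ n` for every prime `p` then `ω_f(p) = 1` (only the residue `0`). [folklore] -/
private theorem polyRootCountMod_eq_one {k : ℕ} {f : Fin k → ℤ[X]}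
    (hf : ∀ p : ℕ, p.Prime → ∀ n : ℕ, ((p : ℤ) ∣ ∏ i, (f i).eval (n : ℤ)) ↔ p ∣ n)
    {p : ℕ} (hp : p.Prime) : polyRootCountMod f p = 1 := by
  unfold polyRootCountMod
  have : ((Finset.range p).filter fun n : ℕ => (p : ℤ) ∣ ∏ i, (f i).eval (n : ℤ)) = {0} := by
    ext n
    simp only [Finset.mem_filter, Finset.mem_range, Finset.mem_singleton, hf p hp]
    constructor
    · rintro ⟨hn, hdvd⟩
      exact Nat.eq_zero_of_dvd_of_lt hdvd hn
    · rintro rfl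
      exact ⟨hp.pos, dvd_zero p⟩
  rw [this, Finset.card_singleton]

/-- … then every ordered partial product of a ONE-polynomial family is `1`, so `C(f) = 1`. [folklore] -/
private theorem batemanHornConst_eq_one {f : Fin 1 → ℤ[X]} (h : ∀ p : ℕ, p.Prime → polyRootCountMod f p = 1) :
    batemanHornConst f = 1 := by
  have hpart : batemanHornPartial f = fun _ => 1 := by
    funext x
    unfold batemanHornPartial
    refine Finset.prod_eq_one fun p hp => ?_
    have hp' := Nat.prime_of_mem_primesLE hp
    have hp0 : (0 : ℝ) < p := by exact_mod_cast hp'.pos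
    have hlt : 1 / (p : ℝ) < 1 := by rw [div_lt_one hp0]; exact_mod_cast hp'.one_lt
    rw [h p hp', Fintype.card_fin, pow_one, Nat.cast_one]
    exact inv_mul_cancel₀ (by linarith)
  rw [batemanHornConst, hpart]
  exact tendsto_const_nhds.limUnder_eq

/-- `p ∣ (-X)(n) ↔ p ∣ n`. [folklore] -/
private theorem negX_dvd_iff (p : ℕ) (_hp : p.Prime) (n : ℕ) :
    ((p : ℤ) ∣ ∏ i, ((![-X] : Fin 1 → ℤ[X]) i).eval (n : ℤ)) ↔ p ∣ n := by
  simp [Int.natCast_dvd_natCast]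

/-- `p ∣ n² ↔ p ∣ n`. [folklore] -/
private theorem sq_dvd_iff (p : ℕ) (hp : p.Prime) (n : ℕ) :
    ((p : ℤ) ∣ ∏ i, ((![X ^ 2] : Fin 1 → ℤ[X]) i).eval (n : ℤ)) ↔ p ∣ n := by
  simp only [Fin.prod_univ_one, Matrix.cons_val_fin_one, eval_pow, eval_X]
  rw [← Nat.cast_pow, Int.natCast_dvd_natCast]
  exact hp.prime.dvd_pow_iff_dvd two_ne_zero

/-- `p ∣ n·n ↔ p ∣ n`. [folklore] -/
private theorem pair_dvd_iff (p : ℕ) (hp : p.Prime) (n : ℕ) :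
    ((p : ℤ) ∣ ∏ i, ((![X, X] : Fin 2 → ℤ[X]) i).eval (n : ℤ)) ↔ p ∣ n := by
  simp only [Fin.prod_univ_two, Matrix.cons_val_zero, Matrix.cons_val_one, eval_X]
  rw [← Nat.cast_mul, Int.natCast_dvd_natCast]
  constructor
  · intro h2; rcases hp.dvd_mul.1 h2 with h2 | h2 <;> exact h2
  · intro h2; exact dvd_mul_of_dvd_left h2 n

/-- `![C 3]` has the fixed prime divisor `3`: `ω(3) = 3`. [folklore] -/
private theorem polyRootCountMod_C_three : polyRootCountMod ![(C 3 : ℤ[X])] 3 = 3 := by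
  unfold polyRootCountMod
  simp

/-- … hence it is NOT a Bateman–Horn system, [folklore] -/
private theorem not_hasNoFixedPrimeDivisor_C_three : ¬HasNoFixedPrimeDivisor ![(C 3 : ℤ[X])] := fun h => by
  have := h 3 Nat.prime_three
  rw [polyRootCountMod_C_three] at this
  exact lt_irrefl _ this

/-- … although it satisfies the three other fields (`C 3` is irreducible in `ℤ[X]` since `3` is prime in `ℤ`;
leading coefficient `3 > 0`; pairwise vacuous), [folklore] -/
private theorem C_three_other_fields :
    (∀ i, Irreducible ((![(C 3 : ℤ[X])]) i)) ∧ (∀ i, 0 < ((![(C 3 : ℤ[X])]) i).leadingCoeff) ∧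
      Pairwise fun i j => ¬Associated ((![(C 3 : ℤ[X])]) i) ((![(C 3 : ℤ[X])]) j) := by
  refine ⟨fun i => ?_, fun i => ?_, Subsingleton.pairwise⟩
  · simpa using (Polynomial.prime_C_iff.2 Int.prime_three).irreducible
  · simp only [Matrix.cons_val_fin_one, leadingCoeff_C]
    norm_num

/-- … its Bateman–Horn constant is `0` (the partial products vanish from `x = 3` on). [folklore] -/
private theorem batemanHornConst_C_three : batemanHornConst ![(C 3 : ℤ[X])] = 0 := by
  refine HasBatemanHornConst.batemanHornConst_eq ?_
  refine (tendsto_const_nhds (x := (0 : ℝ))).congr' ?_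
  filter_upwards [eventually_ge_atTop 3] with x hx
  unfold batemanHornPartial
  symm
  refine Finset.prod_eq_zero (i := 3) (by simp [Nat.mem_primesLE, hx, Nat.prime_three]) ?_
  rw [polyRootCountMod_C_three]
  norm_num

/-- `ω_∅(p) = 0`: the empty product is `1`, never divisible by a prime. [folklore] -/
private theorem polyRootCountMod_fin_zero (f : Fin 0 → ℤ[X]) {p : ℕ} (hp : p.Prime) : polyRootCountMod f p = 0 := by
  unfold polyRootCountMod
  simp only [Finset.univ_eq_empty, Finset.prod_empty, Finset.card_eq_zero, Finset.filter_eq_empty_iff]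
  intro n _ h
  exact hp.not_dvd_one (by exact_mod_cast h)

/-- The empty family IS a Bateman–Horn system (all four fields vacuous / trivial). [folklore] -/
private theorem isBatemanHornSystem_fin_zero (f : Fin 0 → ℤ[X]) : IsBatemanHornSystem f where
  irreducible i := i.elim0
  leadingCoeff_pos i := i.elim0
  pairwise_not_associated i := i.elim0
  hasNoFixedPrimeDivisor p hp := by rw [polyRootCountMod_fin_zero f hp]; exact hp.pos

/-- `C(∅) = 1`: every ordered partial product equals `1`. [folklore] -/
private theorem batemanHornConst_fin_zero (f : Fin 0 → ℤ[X]) : batemanHornConst f = 1 := by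
  have : batemanHornPartial f = fun _ => 1 := by
    funext x
    unfold batemanHornPartial
    refine Finset.prod_eq_one fun p hp => ?_
    rw [polyRootCountMod_fin_zero f (Nat.prime_of_mem_primesLE hp)]
    simp
  rw [batemanHornConst, this]
  exact tendsto_const_nhds.limUnder_eq

/-- `x⁻¹ (x + 1) → 1`. [folklore] -/
private theorem tendsto_inv_mul_succ : Tendsto (fun x : ℕ => (x : ℝ)⁻¹ * (x + 1)) atTop (𝓝 1) := by
  have h : Tendsto (fun x : ℕ => 1 + (x : ℝ)⁻¹) atTop (𝓝 1) := by
    simpa using tendsto_const_nhds.add (tendsto_inv_atTop_nhds_zero_nat (𝕜 := ℝ))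
  refine h.congr' ?_
  filter_upwards [eventually_ne_atTop 0] with x hx
  have : (x : ℝ) ≠ 0 := by exact_mod_cast hx
  field_simp

/-! ## (0) The degenerate instance `k = 0` holds -/

/-- The `k = 0` instance of `LSDRealSegment` HOLDS (with `Λ ≡ 1`): the conclusion of the crux for every family
`f : Fin 0 → ℤ[X]`, stated verbatim (`Ω_∅ ≡ 0`, `H_x = (x+1)/x → 1`, `D = 1`, `Γ^0 = 1`, `C(∅) = 1`). [folklore] -/
theorem lsdRealSegment_fin_zero (f : Fin 0 → ℤ[X]) (_hf : IsBatemanHornSystem f) :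
    ∃ Λ : ℂ → ℂ, DifferentiableOn ℂ Λ (Metric.ball 0 2) ∧ Λ 0 = (batemanHornConst f : ℂ) ∧
      ∀ y : ℝ, 5 / 4 < y → y < 7 / 4 → Filter.Tendsto (fun x : ℕ => (x : ℂ)⁻¹ *
        Complex.exp (((0 : ℕ) : ℂ) * (1 - (y : ℂ)) * (Real.log (Real.log x) : ℂ)) *
        ∑ n ∈ Finset.range (x + 1), (y : ℂ) ^ (∑ i, cardFactors (((f i).eval (n : ℤ)).toNat)))
        Filter.atTop (nhds (Λ y * Complex.exp (((y : ℂ) - 1) *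
          (Real.log (∏ i, ((f i).natDegree : ℝ)) : ℂ)) * (Complex.Gamma y)⁻¹ ^ (0 : ℕ))) := by
  refine ⟨fun _ => 1, differentiableOn_const 1, by rw [batemanHornConst_fin_zero]; simp, fun y _ _ => ?_⟩
  have htarget : (1 : ℂ) * Complex.exp (((y : ℂ) - 1) * (Real.log (∏ i : Fin 0, ((f i).natDegree : ℝ)) : ℂ)) *
      (Complex.Gamma y)⁻¹ ^ 0 = ((1 : ℝ) : ℂ) := by simp
  rw [htarget]
  have := (Complex.continuous_ofReal.tendsto (1 : ℝ)).comp tendsto_inv_mul_succ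
  refine this.congr fun x => ?_
  simp only [Function.comp_apply, Finset.univ_eq_empty, Finset.sum_empty, pow_zero, Finset.sum_const,
    Finset.card_range, nsmul_eq_mul, mul_one, Nat.cast_zero, zero_mul, Complex.exp_zero]
  push_cast
  ring

/-- … which is literally the `k = 0` case of the route decl (the empty family IS a Bateman–Horn system). -/
example (h : Summit.Parity.BatemanHorn.Theses.SelbergDelangeRigidity.LSDRealSegment) (f : Fin 0 → ℤ[X]) :=
  h 0 f (isBatemanHornSystem_fin_zero f)

/-! ## (a) `leadingCoeff_pos` is load-bearing — witness `![-X]` -/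

/-- All values of `-X` on `ℕ` are `≤ 0`, so the typed statistic vanishes identically (`Int.toNat`). [folklore] -/
theorem cardFactorsStat_negX (n : ℕ) :
    (∑ i, cardFactors ((((![-X] : Fin 1 → ℤ[X]) i).eval (n : ℤ)).toNat)) = 0 := by
  simp

/-- DROP `leadingCoeff_pos` ⇒ FALSE. Witness `k = 1`, `f = ![-X]` (irreducible: `-X` is prime; `ω(p) = 1 < p`;
pairwise vacuous): `Ω_f ≡ 0`, so the normalised sum is `x⁻¹(x+1)(log x)^{1-y} → 0` on the segment, hence
`Λ ≡ 0` there (the Γ-factor is non-zero), hence `Λ 0 = 0` by the identity theorem — but `C(-X) = 1`. The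
witness lives on the `toNat` convention for non-positive values. [folklore] -/
theorem lsdRealSegment_false_without_leadingCoeff_pos :
    ¬ ∀ (k : ℕ) (f : Fin k → ℤ[X]), (∀ i, Irreducible (f i)) →
      (Pairwise fun i j => ¬Associated (f i) (f j)) → HasNoFixedPrimeDivisor f →
      ∃ Λ : ℂ → ℂ, DifferentiableOn ℂ Λ (Metric.ball 0 2) ∧ Λ 0 = (batemanHornConst f : ℂ) ∧
        ∀ y : ℝ, 5 / 4 < y → y < 7 / 4 → Filter.Tendsto (fun x : ℕ => (x : ℂ)⁻¹ *
          Complex.exp ((k : ℂ) * (1 - (y : ℂ)) * (Real.log (Real.log x) : ℂ)) *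
          ∑ n ∈ Finset.range (x + 1), (y : ℂ) ^ (∑ i, cardFactors (((f i).eval (n : ℤ)).toNat)))
          Filter.atTop (nhds (Λ y * Complex.exp (((y : ℂ) - 1) * (Real.log (∏ i, ((f i).natDegree : ℝ)) : ℂ)) *
            (Complex.Gamma y)⁻¹ ^ k)) := by
  intro h
  obtain ⟨Λ, hΛ, hΛ0, hlaw⟩ := h 1 ![-X] (fun i => by simpa using Polynomial.prime_X.neg.irreducible)
    Subsingleton.pairwise
    (fun p hp => by rw [polyRootCountMod_eq_one negX_dvd_iff hp]; exact hp.one_lt)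
  have hvan : ∀ y : ℝ, 5 / 4 < y → y < 7 / 4 → Λ y = 0 := fun y hy hy' => by
    have hlim := (hlaw y hy hy').congr fun x => omegaNormSum_eq_ofReal 1 ![-X] y x
    have h0 : Tendsto (fun x : ℕ => (x : ℝ)⁻¹ * Real.exp ((1 : ℕ) * (1 - y) * Real.log (Real.log x)) *
        ∑ n ∈ Finset.range (x + 1), y ^ (∑ i, cardFactors ((((![-X] : Fin 1
            → ℤ[X]) i).eval (n : ℤ)).toNat))) atTop (𝓝 0) := by
      refine (tendsto_zero_of_const_sum le_rfl (by linarith : (1 : ℝ) < y) 1).congr fun x => ?_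
      simp
    have := eq_zero_of_tendsto_ofReal hlim h0
    rw [mul_assoc] at this
    exact (mul_eq_zero.1 this).resolve_right (gammaFactor_ne_zero 1 _ (by linarith))
  have h0 := apply_zero_eq_zero_of_vanish hΛ hvan
  rw [hΛ0, batemanHornConst_eq_one fun p hp => polyRootCountMod_eq_one negX_dvd_iff hp] at h0
  simp at h0

/-! ## (b) `irreducible` is load-bearing — witness `![X ^ 2]` -/

/-- NO cap: `Ω_{![X²]}(n) = Ω(n²) = 2 Ω(n)`. [folklore] -/
theorem cardFactorsStat_sq (n : ℕ) :
    (∑ i, cardFactors ((((![X ^ 2] : Fin 1 → ℤ[X]) i).eval (n : ℤ)).toNat)) = 2 * cardFactors n := by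
  simp only [Fin.sum_univ_one, Matrix.cons_val_fin_one, eval_pow, eval_X]
  rw [← Nat.cast_pow, Int.toNat_natCast, ArithmeticFunction.cardFactors_pow]

/-- `Σ_{n ≤ x} y^{Ω(n²)} ≥ (x/2) log x - x` once `y² ≥ 2`, `y ≥ 0`. [folklore] -/
theorem sum_cardFactorsStat_sq_ge {y : ℝ} (hy : 2 ≤ y ^ 2) (hy0 : 0 ≤ y) (x : ℕ) :
    (x : ℝ) / 2 * Real.log x - x ≤ ∑ n ∈ Finset.range (x + 1), y ^ (∑ i, cardFactors ((((![X ^ 2] : Fin 1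
        → ℤ[X]) i).eval (n : ℤ)).toNat)) := by
  refine (sum_two_pow_omega_ge x).trans ?_
  calc ∑ n ∈ Icc 1 x, (2 : ℝ) ^ n.primeFactors.card
      ≤ ∑ n ∈ Icc 1 x, y ^ (∑ i, cardFactors ((((![X ^ 2] : Fin 1 → ℤ[X]) i).eval (n : ℤ)).toNat)) := by
        refine Finset.sum_le_sum fun n _ => ?_
        rw [cardFactorsStat_sq]
        exact two_pow_omega_le_pow_two_mul_cardFactors hy n
    _ ≤ ∑ n ∈ Finset.range (x + 1), y ^ (∑ i, cardFactors ((((![X ^ 2] : Fin 1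
        → ℤ[X]) i).eval (n : ℤ)).toNat)) :=
        Finset.sum_le_sum_of_subset_of_nonneg (fun n hn => by
          simp only [Finset.mem_Icc, Finset.mem_range] at hn ⊢; omega) fun _ _ _ => by positivity

/-- DROP `irreducible` ⇒ FALSE. Witness `k = 1`, `f = ![X²]` (leading coefficient `1 > 0`, `ω(p) = 1 < p`,
`C(X²) = 1`): `Ω(n²) = 2Ω(n) ≥ 2ω(n)`, so at `y = 3/2` (`y² = 9/4 ≥ 2`, `k(y-1) = 1/2 < 1`) the normalised sum is
`≥ ½ (log x)^{1/2} - 1 → +∞`: no limit exists, whatever `Λ`. [folklore] -/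
theorem lsdRealSegment_false_without_irreducible :
    ¬ ∀ (k : ℕ) (f : Fin k → ℤ[X]), (∀ i, 0 < (f i).leadingCoeff) →
      (Pairwise fun i j => ¬Associated (f i) (f j)) → HasNoFixedPrimeDivisor f →
      ∃ Λ : ℂ → ℂ, DifferentiableOn ℂ Λ (Metric.ball 0 2) ∧ Λ 0 = (batemanHornConst f : ℂ) ∧
        ∀ y : ℝ, 5 / 4 < y → y < 7 / 4 → Filter.Tendsto (fun x : ℕ => (x : ℂ)⁻¹ *
          Complex.exp ((k : ℂ) * (1 - (y : ℂ)) * (Real.log (Real.log x) : ℂ)) *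
          ∑ n ∈ Finset.range (x + 1), (y : ℂ) ^ (∑ i, cardFactors (((f i).eval (n : ℤ)).toNat)))
          Filter.atTop (nhds (Λ y * Complex.exp (((y : ℂ) - 1) * (Real.log (∏ i, ((f i).natDegree : ℝ)) : ℂ)) *
            (Complex.Gamma y)⁻¹ ^ k)) := by
  intro h
  obtain ⟨Λ, _, _, hlaw⟩ := h 1 ![X ^ 2] (fun i => by simp) Subsingleton.pairwise
    (fun p hp => by rw [polyRootCountMod_eq_one sq_dvd_iff hp]; exact hp.one_lt)
  have hlim := (hlaw (3 / 2) (by norm_num) (by norm_num)).congr fun x =>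
    omegaNormSum_eq_ofReal 1 ![X ^ 2] (3 / 2) x
  refine not_tendsto_ofReal_of_tendsto_atTop ?_ _ hlim
  exact tendsto_atTop_of_lower_envelope (by norm_num) (by norm_num)
    fun x _ => sum_cardFactorsStat_sq_ge (by norm_num) (by norm_num) x

/-! ## (c) `pairwise_not_associated` is load-bearing — witness `![X, X]` -/

/-- `Ω_{![X,X]}(n) = 2 Ω(n)`. [folklore] -/
theorem cardFactorsStat_pair (n : ℕ) :
    (∑ i, cardFactors ((((![X, X] : Fin 2 → ℤ[X]) i).eval (n : ℤ)).toNat)) = 2 * cardFactors n := by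
  simp only [Fin.sum_univ_two, Matrix.cons_val_zero, Matrix.cons_val_one, eval_X, Int.toNat_natCast]
  ring

/-- `Σ_{n ≤ x} y^{Ω(n)+Ω(n)} ≥ (x/2) log x - x` once `y² ≥ 2`, `y ≥ 0`. [folklore] -/
theorem sum_cardFactorsStat_pair_ge {y : ℝ} (hy : 2 ≤ y ^ 2) (hy0 : 0 ≤ y) (x : ℕ) :
    (x : ℝ) / 2 * Real.log x - x ≤ ∑ n ∈ Finset.range (x + 1), y ^ (∑ i, cardFactors ((((![X, X] : Fin 2
        → ℤ[X]) i).eval (n : ℤ)).toNat)) := by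
  refine (sum_two_pow_omega_ge x).trans ?_
  calc ∑ n ∈ Icc 1 x, (2 : ℝ) ^ n.primeFactors.card
      ≤ ∑ n ∈ Icc 1 x, y ^ (∑ i, cardFactors ((((![X, X] : Fin 2 → ℤ[X]) i).eval (n : ℤ)).toNat)) := by
        refine Finset.sum_le_sum fun n _ => ?_
        rw [cardFactorsStat_pair]
        exact two_pow_omega_le_pow_two_mul_cardFactors hy n
    _ ≤ ∑ n ∈ Finset.range (x + 1), y ^ (∑ i, cardFactors ((((![X, X] : Fin 2
        → ℤ[X]) i).eval (n : ℤ)).toNat)) :=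
        Finset.sum_le_sum_of_subset_of_nonneg (fun n hn => by
          simp only [Finset.mem_Icc, Finset.mem_range] at hn ⊢; omega) fun _ _ _ => by positivity

/-- DROP `pairwise_not_associated` ⇒ FALSE. Witness `k = 2`, `f = ![X, X]` (both irreducible, leading
coefficient `1`, `ω(p) = 1 < p`; NB `C(X, X) = ∏_p (1-1/p)^{-1} = +∞`, so `batemanHornConst` is junk and the
refutation must come from DIVERGENCE): `Ω_f = 2Ω(n) ≥ 2ω(n)`, so at `y = 29/20` (`y² = 841/400 ≥ 2`,
`k(y-1) = 9/10 < 1`) the normalised sum is `≥ ½ (log x)^{1/10} - 1 → +∞`. [folklore] -/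
theorem lsdRealSegment_false_without_pairwise_not_associated :
    ¬ ∀ (k : ℕ) (f : Fin k → ℤ[X]), (∀ i, Irreducible (f i)) → (∀ i, 0 < (f i).leadingCoeff) →
      HasNoFixedPrimeDivisor f →
      ∃ Λ : ℂ → ℂ, DifferentiableOn ℂ Λ (Metric.ball 0 2) ∧ Λ 0 = (batemanHornConst f : ℂ) ∧
        ∀ y : ℝ, 5 / 4 < y → y < 7 / 4 → Filter.Tendsto (fun x : ℕ => (x : ℂ)⁻¹ *
          Complex.exp ((k : ℂ) * (1 - (y : ℂ)) * (Real.log (Real.log x) : ℂ)) *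
          ∑ n ∈ Finset.range (x + 1), (y : ℂ) ^ (∑ i, cardFactors (((f i).eval (n : ℤ)).toNat)))
          Filter.atTop (nhds (Λ y * Complex.exp (((y : ℂ) - 1) * (Real.log (∏ i, ((f i).natDegree : ℝ)) : ℂ)) *
            (Complex.Gamma y)⁻¹ ^ k)) := by
  intro h
  obtain ⟨Λ, _, _, hlaw⟩ := h 2 ![X, X]
    (fun i => by fin_cases i <;> simpa using Polynomial.prime_X.irreducible)
    (fun i => by fin_cases i <;> simp)
    (fun p hp => by rw [polyRootCountMod_eq_one pair_dvd_iff hp]; exact hp.one_lt)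
  have hlim := (hlaw (29 / 20) (by norm_num) (by norm_num)).congr fun x =>
    omegaNormSum_eq_ofReal 2 ![X, X] (29 / 20) x
  refine not_tendsto_ofReal_of_tendsto_atTop ?_ _ hlim
  exact tendsto_atTop_of_lower_envelope (by norm_num) (by norm_num)
    fun x _ => sum_cardFactorsStat_pair_ge (by norm_num) (by norm_num) x

/-! ## (d) `hasNoFixedPrimeDivisor` is NOT load-bearing — the junk model `![C 3]`

With `hasNoFixedPrimeDivisor` dropped the crux is (conjecturally) STILL TRUE: a fixed prime divisor `p₀` kills the
Euler factor at `0` on both sides (`E_{p₀}(0) = P(p₀ ∤ ∏ f_i(n)) = 0`, and the partial products of `C(f)` contain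
`1 - p₀/p₀ = 0`), so `Λ(0) = 0 = C(f)` consistently while the segment law keeps its shape. The junk model `![C 3]`
satisfies the three other fields (`C_three_other_fields`), violates `hasNoFixedPrimeDivisor`
(`not_hasNoFixedPrimeDivisor_C_three`), has `C = 0` (`batemanHornConst_C_three`) — all imported — and SATISFIES the
conclusion. -/

/-- The statistic of `![C 3]` is the constant `1` (`Ω(3) = 1`). [folklore] -/
theorem cardFactorsStat_C_three (n : ℕ) :
    (∑ i, cardFactors ((((![(C 3 : ℤ[X])] : Fin 1 → ℤ[X]) i).eval (n : ℤ)).toNat)) = 1 := by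
  simp only [Fin.sum_univ_one, Matrix.cons_val_fin_one, eval_C]
  rw [show ((3 : ℤ)).toNat = 3 from rfl]
  exact ArithmeticFunction.cardFactors_apply_prime Nat.prime_three

/-- The junk model `![C 3]` SATISFIES the conclusion of the crux with `Λ ≡ 0` (the normalised sum is
`x⁻¹(x+1)(log x)^{1-y} y → 0`, `C = 0`; `natDegree (C 3) = 0` enters only through `log 0 = 0`). So no
refutation of the crux can come from a fixed prime divisor alone. [folklore] -/
theorem lsdRealSegment_conclusion_C_three :
    ∃ Λ : ℂ → ℂ, DifferentiableOn ℂ Λ (Metric.ball 0 2) ∧ Λ 0 = (batemanHornConst ![(C 3 : ℤ[X])] : ℂ) ∧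
      ∀ y : ℝ, 5 / 4 < y → y < 7 / 4 → Filter.Tendsto (fun x : ℕ => (x : ℂ)⁻¹ *
        Complex.exp (((1 : ℕ) : ℂ) * (1 - (y : ℂ)) * (Real.log (Real.log x) : ℂ)) *
        ∑ n ∈ Finset.range (x + 1), (y : ℂ) ^ (∑ i, cardFactors ((((![(C 3 : ℤ[X])] : Fin 1
            → ℤ[X]) i).eval (n : ℤ)).toNat))) Filter.atTop
        (nhds (Λ y * Complex.exp (((y : ℂ) - 1) *
          (Real.log (∏ i, (((![(C 3 : ℤ[X])] : Fin 1 → ℤ[X]) i).natDegree : ℝ)) : ℂ)) *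
          (Complex.Gamma y)⁻¹ ^ (1 : ℕ))) := by
  refine ⟨fun _ => 0, differentiableOn_const 0, by rw [batemanHornConst_C_three]; simp, fun y hy _ => ?_⟩
  rw [zero_mul, zero_mul]
  have h0 := tendsto_ofReal_of_tendsto (tendsto_zero_of_const_sum le_rfl (by linarith : (1 : ℝ) < y) y)
  rw [Complex.ofReal_zero] at h0
  refine h0.congr fun x => ?_
  rw [omegaNormSum_eq_ofReal 1 _ y x]
  congr 1
  simp only [cardFactorsStat_C_three, pow_one, Finset.sum_const, Finset.card_range, nsmul_eq_mul]
  push_cast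
  ring

/-! ## Certificates: the dropped-field statements are the route decl with one field removed -/

example (h : Summit.Parity.BatemanHorn.Theses.SelbergDelangeRigidity.LSDRealSegment) :
    ∀ (k : ℕ) (f : Fin k → ℤ[X]), (∀ i, Irreducible (f i)) → (∀ i, 0 < (f i).leadingCoeff) →
      (Pairwise fun i j => ¬Associated (f i) (f j)) → HasNoFixedPrimeDivisor f →
      ∃ Λ : ℂ → ℂ, DifferentiableOn ℂ Λ (Metric.ball 0 2) ∧ Λ 0 = (batemanHornConst f : ℂ) ∧
        ∀ y : ℝ, 5 / 4 < y → y < 7 / 4 → Filter.Tendsto (fun x : ℕ => (x : ℂ)⁻¹ *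
          Complex.exp ((k : ℂ) * (1 - (y : ℂ)) * (Real.log (Real.log x) : ℂ)) *
          ∑ n ∈ Finset.range (x + 1), (y : ℂ) ^ (∑ i, ArithmeticFunction.cardFactors (((f i).eval (n : ℤ)).toNat)))
          Filter.atTop (nhds (Λ y * Complex.exp (((y : ℂ) - 1) * (Real.log (∏ i, ((f i).natDegree : ℝ)) : ℂ)) *
            (Complex.Gamma y)⁻¹ ^ k)) :=
  fun k f h1 h2 h3 h4 => h k f ⟨h1, h2, h3, h4⟩

/-- The junk model `![C 3]` is covered by the crux MINUS `hasNoFixedPrimeDivisor`. -/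
example : (∀ i, Irreducible ((![(C 3 : ℤ[X])]) i)) ∧ (∀ i, 0 < ((![(C 3 : ℤ[X])]) i).leadingCoeff) ∧
    (Pairwise fun i j => ¬Associated ((![(C 3 : ℤ[X])]) i) ((![(C 3 : ℤ[X])]) j)) ∧
    ¬HasNoFixedPrimeDivisor ![(C 3 : ℤ[X])] :=
  ⟨C_three_other_fields.1, C_three_other_fields.2.1, C_three_other_fields.2.2, not_hasNoFixedPrimeDivisor_C_three⟩

end Summit.Parity.BatemanHorn.Theorems.LSDRealSegment.Negative
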